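import Summits.QuantumFields.BalabanUV.Beta.FP.FineSplitJunction

/-!
# `BalabanUV.Beta.FP.FineSplitJunctionWindows` — road «FP» for binder row D1, row KER-γ «THE JUNCTION», SOCKET (α0), the LEDGER-SIDE PLUG (E′):
# THE (rem) LETTER OF AN INDUCED COARSE PIECE `u ↦ dressedEntryP (c a ↦ colH K N a 0 c) G (N•(−u)) a b` FROM BOUNDS ON FINITE SQUARE WINDOWS IN ANCHOR FORM —
# (i) ANCHOR FORM: for a block-periodic piece `G` and a block-covariant `K` the `N•(−u)`-shifted sandwich IS the sandwich at `0` with the SECOND column based at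
# the coarse point `u` (the engines' `(v₀, v) = (0, u)`); (ii) SQUARE-WINDOW EXHAUSTION: a summable double series is bounded in absolute value by any uniform
# bound of its partial sums over squares `A ×ˢ A`; (iii) the (rem) letter from windowed anchor-form bounds, uniform in the windows

HONEST DEPENDENCY (page 1, mandatory): continuum YM on T⁴ ⇐ BetaPertH ∧ nine spine estimates (0/9 proved); BetaPertH ⇐ (D1) ∧ (D4) ∧
CAP+tail; G-an2-4 gates asym, D1 and NE2/3/4.  HONEST FRAMING (cell contract, verbatim): «discharging `BetaPertH` makes Bałaban's UV
stability UNCONDITIONAL — a real constructive-QFT result; it is NOT the continuum limit and NOT the Clay problem.»  THIS MODULE is [folklore] bookkeeping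
of absolutely convergent double series over `ℝ` (Mathlib `Filter.tendsto_finsetProd_atTop`-type cofinality, `le_of_tendsto'`) and of block periodicity
(`MomentTransferPeriodic.IsBlockPeriodic`, `PerfectBubbleExpansion.colH_of_blockCov`), composed BY NAME.  WHY: the (rem) engines of the road
(`MixLoopInstanceBlockFamily*.mix*_rem_blockFamily`, `GhostLoopCountingMix*`, `CoarseContractionProfile.pp_of_pair`, …) conclude on FINITE windows of fine base
points with the two columns anchored at `(v₀, v)`, UNIFORMLY in the windows; the ledger currency of (α0) (`FineSplitJunction.hasym_PiBF_of_fineSplit`'s `hpieces`) is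
the `tsum`-level `dressedEntryP` at `N•(−u)` with both columns based at `0`.  This file is the plug between the two, N-power-agnostic (scalar factors ride along).
No `def`, no `def … : Prop`, nothing cited, nothing of the manuscripts under audit asserted, 0 sorry.  NOT any engine instance, NOT the ledger, NOT hsplit,
NOT (ASYMP), NOT D1; 0∕4 row-D1 binders; NOT BetaPertH, NOT continuum, NOT Clay.

ABSOLUTE RULE (cell charter, verbatim): «No internally-minted statement may enter as a cited fact. Every hypothesis is either kernel-proved in this
package or a verbatim quotation of a PUBLISHED theorem with page reference. The manuscript(s) under audit are NOT citable for their own disputed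
steps — they are the thing under adjudication; programme-internal (2001/route/tribunal) claims are never citable.»

CONTENT ([folklore]): §1 `dressedSumP_shift_blockPeriodic` (`dressedSumP w P w′ (y + N•z) = dressedSumP w P (x ↦ w′ (x + N•z)) y` for block-periodic `P`),
**`dressedSumP_colH_anchor`** (`dressedSumP (colH K N a 0 c) G (colH K N b 0 e) (N•(−u)) = dressedSumP (colH K N a 0 c) G (colH K N b u e) 0` — block-periodic `G`,
block-covariant `K`), `dressedEntryP_colH_anchor`; §2 `tendsto_finsetSquare_atTop`, **`abs_tsum_le_of_sq_windows`** (summable `f : Pt × Pt → ℝ`, `|Σ_{A×A} f| ≤ M` for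
every finite `A` ⟹ `|Σ' f| ≤ M`), `abs_dressedSumP_le_of_sq_windows`; §3 **`rem_of_windows`** — the (rem) letter `∀ S, Σ_{u∈S}‖u‖∞²·|dressedEntryP (c a ↦ colH K N a 0 c) G
(N•(−u)) a b| ≤ B` FROM `∀ S A, Σ_{u∈S}‖u‖∞²·|Σ_{c,e} Σ_{p∈A} Σ_{x∈A} colH K N a 0 c p · G c e p x · colH K N b u e x| ≤ B` (bounded block-periodic `G`, block-covariant
`K` with absolutely summable columns).
Provenance: D1 formalisation swarm LEAF PROVER 01, unit `b2b-balaban-beta-d1-formalise-leaf-01` gen 11, 2026-08-21, road FP row KER-γ (α0) ∕ (LEDGER) plug; «not in print; our bookkeeping».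
-/

noncomputable section

namespace Summit.QuantumFields.BalabanUV.Beta.FP.FineSplitJunctionWindows

open Finset Filter Topology
open scoped BigOperators
open Literature.MathematicalPhysics.QuantumFieldTheory.Balaban1983to89
open Literature.MathematicalPhysics.QuantumFieldTheory.Balaban1983to89.Beta
open ExpKernelCalculus (Site MKer shiftK)
open OneStepResolventKernel (Fib)
open OneStepKernelFamily (colH)
open DyadicShell (Pt supNorm)
open Summit.QuantumFields.BalabanUV.Beta.D1BFx.MomentTransferPeriodic (Ker₂ IsBlockPeriodic)
open Summit.QuantumFields.BalabanUV.Beta.D1BFx.MomentTransferPeriodicSum (dressedSumP)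
open Summit.QuantumFields.BalabanUV.Beta.D1BFx.MomentTransferPeriodicEntry (EKer₂ dressedEntryP)
open Summit.QuantumFields.BalabanUV.Beta.FP.TransportInfinityM (colOf)
open Summit.QuantumFields.BalabanUV.Beta.FP.PerfectBubbleExpansion (colH_of_blockCov)
open Summit.QuantumFields.BalabanUV.Beta.FP.FineSplitJunction (summable_abs_colH_of_colOf summable_dressedP_fibre_of_bounded)

/-! ## §1 Anchor form: the coarse shift moves from the evaluation point to the second column's base point -/

section Anchor

/-- [folklore] For a block-periodic two-point table a block shift of the output point is a shift of the RIGHT pattern: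
`dressedSumP w P w′ (y + N•z) = dressedSumP w P (x ↦ w′ (x + N•z)) y` (reindexing `x ↦ x + N•z`; no summability needed). -/
theorem dressedSumP_shift_blockPeriodic {N : ℕ} {P : Ker₂ 4} (hP : IsBlockPeriodic N P) (w w' : Pt → ℝ) (y z : Pt) :
    dressedSumP w P w' (y + (N : ℤ) • z) = dressedSumP w P (fun x => w' (x + (N : ℤ) • z)) y := by
  unfold dressedSumP
  rw [← ((Equiv.refl Pt).prodCongr (Equiv.addRight ((N : ℤ) • z))).tsum_eq]
  refine tsum_congr fun p => ?_
  show w p.1 * P (y + (N : ℤ) • z + p.1) (p.2 + (N : ℤ) • z) * w' (p.2 + (N : ℤ) • z) = w p.1 * P (y + p.1) p.2 * w' (p.2 + (N : ℤ) • z)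
  rw [show y + (N : ℤ) • z + p.1 = (y + p.1) + (N : ℤ) • z by abel, hP z (y + p.1) p.2]

/-- [folklore] **ANCHOR FORM OF THE INDUCED PIECE**: block-periodic `G`, block-covariant `K` (`shiftK (−N•t) K = K`) ⟹
`dressedSumP (colH K N a 0 c) G (colH K N b 0 e) (N•(−u)) = dressedSumP (colH K N a 0 c) G (colH K N b u e) 0` — the first column based at the coarse
point `0`, the second at `u`, output point `0` (the engines' `(v₀, v) := (0, u)`; `PerfectBubbleExpansion.colH_of_blockCov`). -/
theorem dressedSumP_colH_anchor {N : ℕ} {K : MKer (3 + 1) (Fib 3)} (hKcov : ∀ t : Fin (3 + 1) → ℤ, shiftK (-((N : ℤ) • t)) K = K)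
    {G : Ker₂ 4} (hG : IsBlockPeriodic N G) (a c b e : Fin 4) (u : Pt) :
    dressedSumP (colH K N a 0 c) G (colH K N b 0 e) ((N : ℤ) • (-u)) = dressedSumP (colH K N a 0 c) G (colH K N b u e) 0 := by
  have h := dressedSumP_shift_blockPeriodic hG (colH K N a 0 c) (colH K N b 0 e) 0 (-u)
  rw [zero_add] at h
  rw [h]
  congr 1
  funext x
  rw [colH_of_blockCov hKcov b u e x, smul_neg, sub_eq_add_neg]

/-- [folklore] The same for the matrix sandwich: `dressedEntryP (c a ↦ colH K N a 0 c) G (N•(−u)) a b = Σ_{c,e} dressedSumP (colH K N a 0 c) (G c e) (colH K N b u e) 0`. -/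
theorem dressedEntryP_colH_anchor {N : ℕ} {K : MKer (3 + 1) (Fib 3)} (hKcov : ∀ t : Fin (3 + 1) → ℤ, shiftK (-((N : ℤ) • t)) K = K)
    {G : EKer₂ 4} (hG : ∀ c e, IsBlockPeriodic N (G c e)) (a b : Fin 4) (u : Pt) :
    dressedEntryP (fun c a' => colH K N a' 0 c) G ((N : ℤ) • (-u)) a b = ∑ c, ∑ e, dressedSumP (colH K N a 0 c) (G c e) (colH K N b u e) 0 := by
  unfold dressedEntryP
  exact Finset.sum_congr rfl fun c _ => Finset.sum_congr rfl fun e _ => dressedSumP_colH_anchor hKcov (hG c e) a c b e u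

end Anchor

/-! ## §2 Square-window exhaustion -/

section Windows

/-- [folklore] Squares `A ×ˢ A` are cofinal among the finite subsets of `Pt × Pt`. -/
theorem tendsto_finsetSquare_atTop : Tendsto (fun A : Finset Pt => A ×ˢ A) atTop atTop := by
  classical
  refine Monotone.tendsto_atTop_atTop (fun A B h => Finset.product_subset_product h h) fun T => ?_
  refine ⟨T.image Prod.fst ∪ T.image Prod.snd, fun p hp => ?_⟩
  rw [Finset.mem_product]
  exact ⟨Finset.mem_union_left _ (Finset.mem_image_of_mem _ hp), Finset.mem_union_right _ (Finset.mem_image_of_mem _ hp)⟩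

/-- [folklore] **SQUARE-WINDOW EXHAUSTION**: a summable `f : Pt × Pt → ℝ` whose partial sums over every square `A ×ˢ A` are `≤ M` in absolute value has `|Σ' f| ≤ M`. -/
theorem abs_tsum_le_of_sq_windows {f : Pt × Pt → ℝ} {M : ℝ} (hf : Summable f) (h : ∀ A : Finset Pt, |∑ p ∈ A ×ˢ A, f p| ≤ M) :
    |∑' p, f p| ≤ M := by
  have ht : Tendsto (fun A : Finset Pt => |∑ p ∈ A ×ˢ A, f p|) atTop (𝓝 |∑' p, f p|) :=
    (hf.hasSum.comp tendsto_finsetSquare_atTop).abs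
  exact le_of_tendsto' ht h

/-- [folklore] The windowed form of the two-point dressed sum: `|dressedSumP w P w′ y| ≤ M` from `|Σ_{p∈A} Σ_{x∈A} w p·P (y+p) x·w′ x| ≤ M` for every finite `A`
(summable fibre). -/
theorem abs_dressedSumP_le_of_sq_windows {w w' : Pt → ℝ} {P : Ker₂ 4} {y : Pt} {M : ℝ}
    (hs : Summable fun p : Pt × Pt => w p.1 * P (y + p.1) p.2 * w' p.2)
    (h : ∀ A : Finset Pt, |∑ p ∈ A, ∑ x ∈ A, w p * P (y + p) x * w' x| ≤ M) : |dressedSumP w P w' y| ≤ M := by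
  unfold dressedSumP
  refine abs_tsum_le_of_sq_windows hs fun A => ?_
  rw [Finset.sum_product]
  exact h A

end Windows

/-! ## §3 The (rem) letter of an induced piece from windowed anchor-form bounds -/

section Rem

/-- [folklore] The finite sum over `(c, e)` of windowed dressed sums tends to the sum of the dressed sums along the squares. -/
theorem tendsto_sum_sq_windows {ι : Type*} (I : Finset ι) {f : ι → Pt × Pt → ℝ} (hf : ∀ i ∈ I, Summable (f i)) :
    Tendsto (fun A : Finset Pt => ∑ i ∈ I, ∑ p ∈ A ×ˢ A, f i p) atTop (𝓝 (∑ i ∈ I, ∑' p, f i p)) :=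
  tendsto_finsetSum I fun i hi => (hf i hi).hasSum.comp tendsto_finsetSquare_atTop

/-- **THE (rem) LETTER OF AN INDUCED COARSE PIECE FROM WINDOWED BOUNDS IN ANCHOR FORM** [folklore].  `K` block-covariant with absolutely summable END columns
`colOf K`, `G` a BOUNDED block-periodic matrix two-point table, and for every finite coarse set `S` and every finite fine square window `A`
`Σ_{u∈S} ‖u‖∞²·|Σ_{c,e} Σ_{p∈A} Σ_{x∈A} colH K N a 0 c p · G c e p x · colH K N b u e x| ≤ B` (the engines' currency, anchors `(0, u)`) ⟹ the ledger letter of (α0):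
`∀ S, Σ_{u∈S} ‖u‖∞²·|dressedEntryP (c a′ ↦ colH K N a′ 0 c) G (N•(−u)) a b| ≤ B`. -/
theorem rem_of_windows {N : ℕ} {K : MKer (3 + 1) (Fib 3)} (hKcov : ∀ t : Fin (3 + 1) → ℤ, shiftK (-((N : ℤ) • t)) K = K)
    (hcol : ∀ κ l : Fin 4, Summable fun x => |colOf K κ l x|)
    {G : EKer₂ 4} (hG : ∀ c e, IsBlockPeriodic N (G c e)) (hGb : ∀ c e, ∃ A, ∀ s s', |G c e s s'| ≤ A) {a b : Fin 4} {B : ℝ}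
    (h : ∀ (S : Finset Pt) (A : Finset Pt),
      ∑ u ∈ S, (supNorm u : ℝ) ^ 2 * |∑ c, ∑ e, ∑ p ∈ A, ∑ x ∈ A, colH K N a 0 c p * G c e p x * colH K N b u e x| ≤ B) :
    ∀ S : Finset Pt, ∑ u ∈ S, (supNorm u : ℝ) ^ 2 * |dressedEntryP (fun c a' => colH K N a' 0 c) G ((N : ℤ) • (-u)) a b| ≤ B := by
  intro S
  -- anchor form, termwise
  have hanchor : ∀ u, dressedEntryP (fun c a' => colH K N a' 0 c) G ((N : ℤ) • (-u)) a b
      = ∑ c, ∑ e, dressedSumP (colH K N a 0 c) (G c e) (colH K N b u e) 0 := fun u => dressedEntryP_colH_anchor hKcov hG a b u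
  simp only [hanchor]
  -- summability of every anchor-form fibre
  have hcolH0 : ∀ c a', Summable fun x => |colH K N a' 0 c x| := fun c a' => summable_abs_colH_of_colOf hcol N c a'
  have hcolHu : ∀ (u : Pt) c a', Summable fun x => |colH K N a' u c x| := by
    intro u c a'
    have h0 := hcolH0 c a'
    have e : (fun x => |colH K N a' u c x|) = (fun x => |colH K N a' 0 c x|) ∘ fun x => x - (N : ℤ) • u := by
      funext x; simp only [Function.comp, colH_of_blockCov hKcov a' u c x]
    rw [e]
    exact (Equiv.subRight ((N : ℤ) • u)).summable_iff.mpr h0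
  have hfib : ∀ (u : Pt) (c e : Fin 4),
      Summable fun p : Pt × Pt => colH K N a 0 c p.1 * G c e (0 + p.1) p.2 * colH K N b u e p.2 := by
    intro u c e
    obtain ⟨A, hA⟩ := hGb c e
    exact summable_dressedP_fibre_of_bounded (hcolH0 c a) hA (hcolHu u e b) 0
  -- the windowed finite sums tend to the target; pass to the limit
  have ht : Tendsto (fun A : Finset Pt => ∑ u ∈ S, (supNorm u : ℝ) ^ 2 *
      |∑ c, ∑ e, ∑ p ∈ A ×ˢ A, colH K N a 0 c p.1 * G c e (0 + p.1) p.2 * colH K N b u e p.2|) atTop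
      (𝓝 (∑ u ∈ S, (supNorm u : ℝ) ^ 2 * |∑ c, ∑ e, dressedSumP (colH K N a 0 c) (G c e) (colH K N b u e) 0|)) := by
    refine tendsto_finsetSum S fun u _ => Tendsto.const_mul _ (Tendsto.abs ?_)
    have h1 := tendsto_sum_sq_windows (Finset.univ : Finset (Fin 4 × Fin 4))
      (f := fun ce p => colH K N a 0 ce.1 p.1 * G ce.1 ce.2 (0 + p.1) p.2 * colH K N b u ce.2 p.2) (fun ce _ => hfib u ce.1 ce.2)
    simp only [Fintype.sum_prod_type] at h1
    exact h1
  refine le_of_tendsto' ht fun A => ?_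
  have e : ∀ u, (∑ c, ∑ e, ∑ p ∈ A ×ˢ A, colH K N a 0 c p.1 * G c e (0 + p.1) p.2 * colH K N b u e p.2)
      = ∑ c, ∑ e, ∑ p ∈ A, ∑ x ∈ A, colH K N a 0 c p * G c e p x * colH K N b u e x := fun u => by
    refine Finset.sum_congr rfl fun c _ => Finset.sum_congr rfl fun e _ => ?_
    rw [Finset.sum_product]
    simp only [zero_add]
  simp only [e]
  exact h S A

end Rem

end Summit.QuantumFields.BalabanUV.Beta.FP.FineSplitJunctionWindows

end
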